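import Summits.RiemannHypothesis.RiemannHypothesis.Theorems.HandoffCramer
import HarnessLib

/-!
# HANDOFF, edge block: the ASYMPTOTIC converse — a Cramér-order gap (constant ½) gives the edge block for every `q ≥ e⁸⁰` (rh-explicit, track «HANDOFF», seat prove-2 gen3, ATTEMPT-8)

HONEST FRAMING. Nothing here bears on the truth of RH. `HandoffCramer.lean` proved the (⇒) half of the
classification of the ODD edge block: `EdgeNonnegOdd q q′ η → q′ − q ≤ C·√q·log q`. The (⇐) half was, so far, the
per-window reduction `edgeNonneg_of_gapIneq_param` plus one real inequality per window, checked OUTSIDE Lean on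
`[1693, 4·10¹⁸]` (ATTEMPT-6 §4). This file makes the (⇐) half a theorem for ALL large `q`:

* `edgeNonneg_of_gap_le` — for consecutive primes `q < q′` with `q ≥ e⁸⁰`, a gap `q′ − q ≤ ½·√q·log q` and an overlap
  `0 < η ≤ 1/(4q)` give the FULL edge block `EdgeNonneg q q′ η` (both parities) (PROVED). The level of the parametric
  lobe coercivity is taken at `K = √q/(log q)²`, where it is worth `≥ 0.49949·log q − 2 log log q − 3.142`
  (`lobeCoercivity_ge_of_level`), while the cross constant is `≤ 0.25034·log q + 6.1003` (`handoffCrossConst_le_of_gap_le`: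
  polar part `e^b·D ≤ 1.00135·(log q)/4 + 0.0003`, even part `≤ 6.1` by `handoffCrossConstEven_le_of_large` — no gap table).
* `edgeNonnegOdd_gap_sandwich` — the TWO-SIDED classification in one statement: for `q ≥ e⁸⁰`,
  `q′ − q ≤ ½√q log q ⟹ EdgeNonnegOdd q q′ η ⟹ q′ − q ≤ cramerGapConst·√q log q` (PROVED). So «the odd edge block for
  all large q» sits between two Cramér-order prime-gap statements (open unconditionally: Baker–Harman–Pintz give
  `q^{0.525}`); it is implied by Cramér's conjecture and it implies Cramér's RH-conditional order of magnitude.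
* `forall_edgeNonneg_of_gap_hypothesis` — under the gap hypothesis from `q₁` on, the edge block holds for every
  `q ≥ max(q₁, e⁸⁰)` (PROVED; book-keeping).

The constant `½` is not optimal (ATTEMPT-7 §3: the sufficient constant tends to `1⁻`, the refuting one to `≈ 1.1–1.7`
depending on the profile); `e⁸⁰` is where `0.2125·log q ≥ 15.25` holds with room, not a natural barrier.
-/

set_option linter.dupNamespace false

noncomputable section

open Complex Filter Set MeasureTheory Literature.NumberTheory.LFunctions
open scoped Real Topology ComplexConjugate ContDiff

namespace Summit.RiemannHypothesis.RiemannHypothesis.Theorems.Handoff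

variable {q q' : ℕ}

/-! ## §1 Numerical lemmas -/

/-- `10⁷ ≤ e¹⁷`. [folklore] -/
theorem ten_pow_seven_le_exp_seventeen : (10 : ℝ) ^ 7 ≤ Real.exp 17 := by
  have h : Real.exp 17 = Real.exp 1 ^ 17 := by rw [← Real.exp_nat_mul]; norm_num
  rw [h]
  have h1 := Real.exp_one_gt_d9
  calc (10 : ℝ) ^ 7 ≤ (2.7182818283 : ℝ) ^ 17 := by norm_num
    _ ≤ Real.exp 1 ^ 17 := pow_le_pow_left₀ (by norm_num) h1.le 17

/-- `log x ≤ 3 + 0.01832·x` for `x > 0` (tangent of `log` at `e⁴`, `e⁻⁴ ≤ 0.01832`). [folklore] -/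
theorem log_le_three_add {x : ℝ} (hx : 0 < x) : Real.log x ≤ 3 + 0.01832 * x := by
  have h4 := exp_four_ge
  have he : 0 < Real.exp 4 := Real.exp_pos 4
  have h1 : Real.log x = Real.log (x / Real.exp 4) + 4 := by
    rw [Real.log_div hx.ne' he.ne', Real.log_exp]; ring
  have h2 : Real.log (x / Real.exp 4) ≤ x / Real.exp 4 - 1 := Real.log_le_sub_one_of_pos (div_pos hx he)
  have h3 : x / Real.exp 4 ≤ 0.01832 * x := by
    rw [div_le_iff₀ he]; nlinarith
  linarith

/-- `(log x)² ≤ 64·x^{1/4}` for `x ≥ 1` (`log x ≤ 8·x^{1/8}`). [folklore] -/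
theorem log_sq_le_sixtyfour_mul_rpow_quarter {x : ℝ} (hx : 1 ≤ x) : Real.log x ^ 2 ≤ 64 * x ^ (1 / 4 : ℝ) := by
  have h0 : 0 ≤ x := by linarith
  have h1 : Real.log x ≤ x ^ (1 / 8 : ℝ) / (1 / 8) := Real.log_le_rpow_div h0 (by norm_num)
  have hl0 : 0 ≤ Real.log x := Real.log_nonneg hx
  have h2 : Real.log x ≤ 8 * x ^ (1 / 8 : ℝ) := by linarith
  have h3 : Real.log x ^ 2 ≤ (8 * x ^ (1 / 8 : ℝ)) ^ 2 := pow_le_pow_left₀ hl0 h2 2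
  have h4 : (x ^ (1 / 8 : ℝ)) ^ 2 = x ^ (1 / 4 : ℝ) := by
    rw [← Real.rpow_natCast, ← Real.rpow_mul h0]; norm_num
  rw [mul_pow, h4] at h3
  linarith

/-! ## §2 The two estimates -/

/-- **Lobe coercivity at a high level.** If `ℓ ≥ 80`, `0 ≤ D ≤ 0.0024`, `K ≥ 2` with `log K = ℓ/2 − 2 log ℓ` and
`D·K ≤ 0.0032`, then `lobeCoercivity D K ≥ 0.49949·ℓ − 2 log ℓ − 3.142` (`L_K ≥ log K − 1.9786`, `log π ≤ 1.1448`,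
`2(sinh(D/2) − D/2) ≤ 0.0142`, `(DK/π)(L_K + 4.2275) ≤ 0.00102·(ℓ/2 + 3.5344)`). [cite: Bombieri2000, §12 eqs. (12.3)–(12.9); this track, ATTEMPT-8] -/
theorem lobeCoercivity_ge_of_level {ℓ D K : ℝ} (hℓ : 80 ≤ ℓ) (hD0 : 0 ≤ D) (hD : D ≤ 0.0024) (hK : 2 ≤ K)
    (hlogK : Real.log K = ℓ / 2 - 2 * Real.log ℓ) (hDK : D * K ≤ 0.0032) :
    0.49949 * ℓ - 2 * Real.log ℓ - 3.142 ≤ lobeCoercivity D K := by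
  have hL := weilLevel_bounds hK
  have hlogℓ : 0 ≤ Real.log ℓ := Real.log_nonneg (by linarith)
  have hDlog2 : D / 2 ≤ Real.log 2 / 2 := by have := Real.log_two_gt_d9; linarith
  have hsinh : 2 * (Real.sinh (D / 2) - D / 2) ≤ 0.0142 := two_mul_sinh_sub_le hDlog2
  have hlpi := Literature.Analysis.SpecialFunctions.Real.log_pi_le
  have hterm : D * K / π * (weilLevel K + 4.22745354) ≤ 0.00051 * ℓ + 0.0037 := by
    have hpos : 0 ≤ weilLevel K + 4.22745354 := by
      have : 0 ≤ Real.log K := Real.log_nonneg (by linarith)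
      linarith [hL.1]
    have hup : weilLevel K + 4.22745354 ≤ ℓ / 2 + 3.5344 := by linarith [hL.2, hlogK, hlogℓ]
    have hcoef : D * K / π ≤ 0.00102 := by
      rw [div_le_iff₀ Real.pi_pos]; linarith [Real.pi_gt_d6, hDK]
    have hcoef0 : 0 ≤ D * K / π := by
      have : 0 ≤ D * K := mul_nonneg hD0 (by linarith)
      positivity
    calc D * K / π * (weilLevel K + 4.22745354) ≤ 0.00102 * (ℓ / 2 + 3.5344) :=
          mul_le_mul hcoef hup hpos (by norm_num)
      _ ≤ 0.00051 * ℓ + 0.0037 := by linarith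
  unfold lobeCoercivity
  linarith [hL.1, hlogK, hsinh, hlpi, hterm]

/-- **The cross constant under a Cramér-order gap.** For consecutive primes `q < q′` with `q ≥ e⁸⁰`,
`q′ − q ≤ ½·√q·log q`, `0 < η ≤ 1/(4q)` and `b` in the window: `handoffCrossConst q η b ≤ 0.25034·log q + 6.1003`
(`X = (e^b + e^{−c′})·D + X_ev`, `e^b ≤ √q′ ≤ 1.00135√q`, `D ≤ (log q)/(4√q) + η`, `η√q ≤ 0.00025`, `X_ev ≤ 6.1`).
[this track, ATTEMPT-8] -/
theorem handoffCrossConst_le_of_gap_le (hcons : ConsecutivePrimes q q') (hq : Real.exp 80 ≤ q)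
    (hgap : (q' : ℝ) - q ≤ Real.sqrt q * Real.log q / 2) {η b : ℝ} (hη : 0 < η) (hηq : η ≤ 1 / (4 * q))
    (hb : b ∈ Icc (Real.log q / 2) (Real.log q' / 2)) :
    handoffCrossConst q η b ≤ 0.25034 * Real.log q + 6.1003 := by
  have hq0 : (0 : ℝ) < q := by exact_mod_cast hcons.1.pos
  have hqq' : (q : ℝ) < q' := by exact_mod_cast hcons.2.2.1
  have hq'0 : (0 : ℝ) < q' := hq0.trans hqq'
  have hℓ80 : 80 ≤ Real.log q := by rw [Real.le_log_iff_exp_le hq0]; exact hq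
  have hℓ0 : 0 < Real.log q := by linarith
  have h16 : Real.exp 16 ≤ q := (Real.exp_le_exp.2 (by norm_num)).trans hq
  have h7 : (10 : ℝ) ^ 7 ≤ q :=
    ten_pow_seven_le_exp_seventeen.trans ((Real.exp_le_exp.2 (by norm_num)).trans hq)
  have hcap : Real.log q / Real.sqrt q ≤ 0.0054 := log_div_sqrt_le_of_exp_sixteen_le h16
  have hsq : 0 < Real.sqrt q := Real.sqrt_pos.2 hq0
  have hsqsq : Real.sqrt q * Real.sqrt q = q := Real.mul_self_sqrt hq0.le
  have hsq1000 : (1000 : ℝ) ≤ Real.sqrt q := by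
    have e : Real.sqrt (Real.exp 80) = Real.exp 40 := by
      rw [show (80 : ℝ) = 40 + 40 by norm_num, Real.exp_add, Real.sqrt_mul_self (Real.exp_pos 40).le]
    have h1 : Real.exp 40 ≤ Real.sqrt q := by rw [← e]; exact Real.sqrt_le_sqrt hq
    exact (exp_seven_ge.trans (Real.exp_le_exp.2 (by norm_num))).trans h1
  -- log q · √q ≤ 0.0054 q
  have hℓsq : Real.log q * Real.sqrt q ≤ 0.0054 * q := by
    have h1 : Real.log q ≤ 0.0054 * Real.sqrt q := by rwa [div_le_iff₀ hsq] at hcap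
    calc Real.log q * Real.sqrt q ≤ 0.0054 * Real.sqrt q * Real.sqrt q := mul_le_mul_of_nonneg_right h1 hsq.le
      _ = 0.0054 * q := by rw [mul_assoc, hsqsq]
  -- η√q ≤ 0.00025
  have hηsq : η * Real.sqrt q ≤ 0.00025 := by
    have h1 : η * Real.sqrt q ≤ 1 / (4 * q) * Real.sqrt q := mul_le_mul_of_nonneg_right hηq hsq.le
    have h2 : 1 / (4 * q) * Real.sqrt q ≤ 0.00025 := by
      rw [div_mul_eq_mul_div, one_mul, div_le_iff₀ (by positivity)]
      have h3 : 1000 * Real.sqrt q ≤ Real.sqrt q * Real.sqrt q := mul_le_mul_of_nonneg_right hsq1000 hsq.le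
      rw [hsqsq] at h3
      linarith
    exact h1.trans h2
  -- the gap in logarithmic scale: log q′ − log q ≤ (log q)/(2√q)
  have hlogdiff : Real.log q' - Real.log q ≤ Real.log q / (2 * Real.sqrt q) := by
    have h1 : Real.log q' - Real.log q = Real.log (q' / q) := by rw [Real.log_div hq'0.ne' hq0.ne']
    have h2 : Real.log ((q' : ℝ) / q) ≤ q' / q - 1 := Real.log_le_sub_one_of_pos (div_pos hq'0 hq0)
    have h3 : (q' : ℝ) / q - 1 = (q' - q) / q := by field_simp
    have h4 : ((q' : ℝ) - q) / q ≤ Real.log q / (2 * Real.sqrt q) := by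
      rw [div_le_div_iff₀ hq0 (by positivity)]
      have h5 : Real.sqrt q * Real.log q / 2 * (2 * Real.sqrt q) = Real.log q * (Real.sqrt q * Real.sqrt q) := by
        ring
      rw [hsqsq] at h5
      have h6 : ((q' : ℝ) - q) * (2 * Real.sqrt q) ≤ Real.sqrt q * Real.log q / 2 * (2 * Real.sqrt q) :=
        mul_le_mul_of_nonneg_right hgap (by positivity)
      linarith [h5.le, h5.ge, h6]
    linarith [h1.ge, h2, h3.le, h4]
  -- √q′ ≤ 1.00135 √q
  have hq'le : (q' : ℝ) ≤ 1.0027 * q := by linarith [hgap, hℓsq]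
  have hsq' : Real.sqrt q' ≤ 1.00135 * Real.sqrt q := by
    refine Real.sqrt_le_iff.2 ⟨by positivity, ?_⟩
    have : (1.00135 * Real.sqrt q) ^ 2 = 1.00135 ^ 2 * (Real.sqrt q * Real.sqrt q) := by ring
    rw [this, hsqsq]
    linarith
  -- the window length
  set c' : ℝ := Real.log q / 2 - η with hc'
  set D : ℝ := b - c' with hD_def
  have hD0 : 0 ≤ D := by simp only [hD_def, hc']; linarith [hb.1]
  have hDle : D ≤ Real.log q / (4 * Real.sqrt q) + η := by
    simp only [hD_def, hc']
    have : Real.log q / (4 * Real.sqrt q) = Real.log q / (2 * Real.sqrt q) / 2 := by ring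
    linarith [hb.2, hlogdiff]
  have hℓ4sq : Real.log q / (4 * Real.sqrt q) ≤ 0.00135 := by
    have : Real.log q / (4 * Real.sqrt q) = Real.log q / Real.sqrt q / 4 := by ring
    linarith [hcap]
  have hηsmall : η ≤ 0.001 := by
    have : (1 : ℝ) / (4 * q) ≤ 0.001 := by
      rw [div_le_iff₀ (by positivity)]; linarith [h7]
    exact hηq.trans this
  have hDsmall : D ≤ 0.0024 := by linarith
  -- split off the even constant
  have hXev := handoffCrossConstEven_le_of_large hcons h7 hη hηq hb
  have hsplit : handoffCrossConst q η b = (Real.exp b + Real.exp (-c')) * D + handoffCrossConstEven q η b := by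
    simp only [handoffCrossConst, handoffCrossConstEven, hD_def, hc']; ring
  have heb : Real.exp b ≤ 1.00135 * Real.sqrt q := by
    have h1 : Real.exp b ≤ Real.exp (Real.log q' / 2) := Real.exp_le_exp.2 hb.2
    have h3 : Real.exp (Real.log q' / 2) * Real.exp (Real.log q' / 2) = q' := by
      rw [← Real.exp_add, add_halves, Real.exp_log hq'0]
    have h2 : Real.exp (Real.log q' / 2) = Real.sqrt q' := by
      rw [← Real.sqrt_mul_self (Real.exp_pos (Real.log q' / 2)).le, h3]
    linarith [h1, h2.le, hsq']
  have hec' : Real.exp (-c') ≤ 0.001 := by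
    have h1 : 7 ≤ c' := by simp only [hc']; linarith
    have h2 : Real.exp (-c') ≤ Real.exp (-7) := Real.exp_le_exp.2 (by linarith)
    have h3 : Real.exp (-7) * Real.exp 7 = 1 := by rw [← Real.exp_add]; norm_num
    nlinarith [exp_seven_ge, Real.exp_pos (-7)]
  have hpolar : (Real.exp b + Real.exp (-c')) * D ≤ 0.25034 * Real.log q + 0.0003 := by
    have h1 : Real.exp b * D ≤ 1.00135 * Real.sqrt q * D := mul_le_mul_of_nonneg_right heb hD0
    have h2 : Real.sqrt q * D ≤ Real.log q / 4 + 0.00025 := by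
      have h3 : Real.sqrt q * D ≤ Real.sqrt q * (Real.log q / (4 * Real.sqrt q) + η) :=
        mul_le_mul_of_nonneg_left hDle hsq.le
      have h4 : Real.sqrt q * (Real.log q / (4 * Real.sqrt q) + η) = Real.log q / 4 + η * Real.sqrt q := by
        field_simp
      linarith [h3, h4.le, hηsq]
    have h2' : 1.00135 * Real.sqrt q * D ≤ 1.00135 * (Real.log q / 4 + 0.00025) := by
      rw [mul_assoc]; exact mul_le_mul_of_nonneg_left h2 (by norm_num)
    have h5 : Real.exp (-c') * D ≤ 0.001 * 0.0024 := mul_le_mul hec' hDsmall hD0 (by norm_num)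
    rw [add_mul]
    linarith [h1, h2', h5]
  rw [hsplit]
  linarith [hpolar, hXev]

/-! ## §3 The asymptotic converse and the two-sided classification -/

/-- **The edge block from a Cramér-order gap, for every `q ≥ e⁸⁰`.** For consecutive primes `q < q′` with `e⁸⁰ ≤ q`,
`q′ − q ≤ ½·√q·log q` and an overlap `0 < η ≤ 1/(4q)`: `EdgeNonneg q q′ η` (both parities). Proof:
`edgeNonneg_of_gapIneq_param` at the level `K = √q/(log q)²` (`K ≥ 2`, `log K = ℓ/2 − 2 log ℓ`, `D·K ≤ 1/(4ℓ) + η√q/ℓ²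
≤ 0.0032`, `ℓ = log q`); the cross constant is `≤ 0.25034ℓ + 6.1003` (`handoffCrossConst_le_of_gap_le`), the lobe
coercivity `≥ 0.49949ℓ − 2 log ℓ − 3.142` (`lobeCoercivity_ge_of_level`), and `2 log ℓ ≤ 6 + 0.0367ℓ` closes the
comparison for `ℓ ≥ 80` (margin `0.2125ℓ − 15.25`). The (⇐) direction of ATTEMPT-7 §4(i), formerly a per-window inequality
checked outside Lean, is thereby a theorem for all large `q`. Nothing here bears on RH.
[this track, ATTEMPT-8; cite: Bombieri2000, §12 eqs. (12.3)–(12.9)] -/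
theorem edgeNonneg_of_gap_le (hcons : ConsecutivePrimes q q') (hq : Real.exp 80 ≤ q)
    (hgap : (q' : ℝ) - q ≤ Real.sqrt q * Real.log q / 2) {η : ℝ} (hη : 0 < η) (hηq : η ≤ 1 / (4 * q)) :
    EdgeNonneg q q' η := by
  have hq0 : (0 : ℝ) < q := by exact_mod_cast hcons.1.pos
  have hqq' : (q : ℝ) < q' := by exact_mod_cast hcons.2.2.1
  have hq'0 : (0 : ℝ) < q' := hq0.trans hqq'
  have hℓ80 : 80 ≤ Real.log q := by rw [Real.le_log_iff_exp_le hq0]; exact hq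
  have hℓ0 : 0 < Real.log q := by linarith
  have h16 : Real.exp 16 ≤ q := (Real.exp_le_exp.2 (by norm_num)).trans hq
  have h7 : (10 : ℝ) ^ 7 ≤ q :=
    ten_pow_seven_le_exp_seventeen.trans ((Real.exp_le_exp.2 (by norm_num)).trans hq)
  have hcap : Real.log q / Real.sqrt q ≤ 0.0054 := log_div_sqrt_le_of_exp_sixteen_le h16
  have hsq : 0 < Real.sqrt q := Real.sqrt_pos.2 hq0
  have hsqsq : Real.sqrt q * Real.sqrt q = q := Real.mul_self_sqrt hq0.le
  have hsq1000 : (1000 : ℝ) ≤ Real.sqrt q := by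
    have e : Real.sqrt (Real.exp 80) = Real.exp 40 := by
      rw [show (80 : ℝ) = 40 + 40 by norm_num, Real.exp_add, Real.sqrt_mul_self (Real.exp_pos 40).le]
    have h1 : Real.exp 40 ≤ Real.sqrt q := by rw [← e]; exact Real.sqrt_le_sqrt hq
    exact (exp_seven_ge.trans (Real.exp_le_exp.2 (by norm_num))).trans h1
  have hηsq : η * Real.sqrt q ≤ 0.00025 := by
    have h1 : η * Real.sqrt q ≤ 1 / (4 * q) * Real.sqrt q := mul_le_mul_of_nonneg_right hηq hsq.le
    have h2 : 1 / (4 * q) * Real.sqrt q ≤ 0.00025 := by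
      rw [div_mul_eq_mul_div, one_mul, div_le_iff₀ (by positivity)]
      have h3 : 1000 * Real.sqrt q ≤ Real.sqrt q * Real.sqrt q := mul_le_mul_of_nonneg_right hsq1000 hsq.le
      rw [hsqsq] at h3
      linarith
    exact h1.trans h2
  have hηsmall : η ≤ 0.001 := by
    have : (1 : ℝ) / (4 * q) ≤ 0.001 := by
      rw [div_le_iff₀ (by positivity)]; linarith [h7]
    exact hηq.trans this
  have hη' : η < Real.log q / 2 := by linarith
  have hη2 : η < Real.log 2 / 2 := by have := Real.log_two_gt_d9; linarith
  -- log q′ − log q ≤ (log q)/(2√q)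
  have hlogdiff : Real.log q' - Real.log q ≤ Real.log q / (2 * Real.sqrt q) := by
    have h1 : Real.log q' - Real.log q = Real.log (q' / q) := by rw [Real.log_div hq'0.ne' hq0.ne']
    have h2 : Real.log ((q' : ℝ) / q) ≤ q' / q - 1 := Real.log_le_sub_one_of_pos (div_pos hq'0 hq0)
    have h3 : (q' : ℝ) / q - 1 = (q' - q) / q := by field_simp
    have h4 : ((q' : ℝ) - q) / q ≤ Real.log q / (2 * Real.sqrt q) := by
      rw [div_le_div_iff₀ hq0 (by positivity)]
      have h5 : Real.sqrt q * Real.log q / 2 * (2 * Real.sqrt q) = Real.log q * (Real.sqrt q * Real.sqrt q) := by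
        ring
      rw [hsqsq] at h5
      have h6 : ((q' : ℝ) - q) * (2 * Real.sqrt q) ≤ Real.sqrt q * Real.log q / 2 * (2 * Real.sqrt q) :=
        mul_le_mul_of_nonneg_right hgap (by positivity)
      linarith [h5.le, h5.ge, h6]
    linarith [h1.ge, h2, h3.le, h4]
  -- the level K = √q/(log q)²
  set ℓ : ℝ := Real.log q with hℓ
  set K : ℝ := Real.sqrt q / ℓ ^ 2 with hK_def
  have hℓ2 : 0 < ℓ ^ 2 := by positivity
  have hK0 : 0 < K := div_pos hsq hℓ2
  have hq1 : (1 : ℝ) ≤ q := by linarith [Real.one_le_exp (by norm_num : (0:ℝ) ≤ 16), h16]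
  have hK2 : 2 ≤ K := by
    rw [hK_def, le_div_iff₀ hℓ2]
    have h1 : ℓ ^ 2 ≤ 64 * (q : ℝ) ^ (1 / 4 : ℝ) := log_sq_le_sixtyfour_mul_rpow_quarter hq1
    have h2 : Real.sqrt q = (q : ℝ) ^ (1 / 4 : ℝ) * (q : ℝ) ^ (1 / 4 : ℝ) := by
      rw [Real.sqrt_eq_rpow, ← Real.rpow_add hq0]; norm_num
    have h3 : Real.exp 20 ≤ (q : ℝ) ^ (1 / 4 : ℝ) := by
      have e : Real.exp 80 ^ (1 / 4 : ℝ) = Real.exp 20 := by rw [← Real.exp_mul]; norm_num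
      rw [← e]; exact Real.rpow_le_rpow (Real.exp_pos 80).le hq (by norm_num)
    have h4 : (128 : ℝ) ≤ Real.exp 20 :=
      (by linarith [exp_seven_ge] : (128 : ℝ) ≤ Real.exp 7).trans (Real.exp_le_exp.2 (by norm_num))
    have h5 : 0 ≤ (q : ℝ) ^ (1 / 4 : ℝ) := Real.rpow_nonneg hq0.le _
    calc 2 * ℓ ^ 2 ≤ 128 * (q : ℝ) ^ (1 / 4 : ℝ) := by linarith
      _ ≤ (q : ℝ) ^ (1 / 4 : ℝ) * (q : ℝ) ^ (1 / 4 : ℝ) := mul_le_mul_of_nonneg_right (h4.trans h3) h5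
      _ = Real.sqrt q := h2.symm
  have hlogK : Real.log K = ℓ / 2 - 2 * Real.log ℓ := by
    rw [hK_def, Real.log_div hsq.ne' hℓ2.ne', Real.log_sqrt hq0.le, Real.log_pow]
    push_cast
    ring
  refine edgeNonneg_of_gapIneq_param hcons hη hη' hη2 fun b hb ↦ ⟨K, hK2, ?_⟩
  -- the window length D and D·K
  set D : ℝ := b - (Real.log q / 2 - η) with hD_def
  have hD0 : 0 ≤ D := by simp only [hD_def]; linarith [hb.1]
  have hDle : D ≤ ℓ / (4 * Real.sqrt q) + η := by
    simp only [hD_def]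
    have : ℓ / (4 * Real.sqrt q) = ℓ / (2 * Real.sqrt q) / 2 := by ring
    linarith [hb.2, hlogdiff]
  have hℓ4sq : ℓ / (4 * Real.sqrt q) ≤ 0.00135 := by
    have : ℓ / (4 * Real.sqrt q) = ℓ / Real.sqrt q / 4 := by ring
    linarith [hcap]
  have hDsmall : D ≤ 0.0024 := by linarith
  have hDK : D * K ≤ 0.0032 := by
    have h1 : D * K ≤ (ℓ / (4 * Real.sqrt q) + η) * K := mul_le_mul_of_nonneg_right hDle hK0.le
    have h2 : (ℓ / (4 * Real.sqrt q) + η) * K = 1 / (4 * ℓ) + η * Real.sqrt q / ℓ ^ 2 := by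
      rw [hK_def]
      field_simp
    have h3 : 1 / (4 * ℓ) ≤ 1 / 320 := by
      rw [div_le_div_iff₀ (by positivity) (by norm_num)]; linarith
    have h4 : η * Real.sqrt q / ℓ ^ 2 ≤ 0.00025 / 6400 := by
      have h5 : (6400 : ℝ) ≤ ℓ ^ 2 := by nlinarith
      calc η * Real.sqrt q / ℓ ^ 2 ≤ 0.00025 / ℓ ^ 2 := div_le_div_of_nonneg_right hηsq hℓ2.le
        _ ≤ 0.00025 / 6400 := div_le_div_of_nonneg_left (by norm_num) (by norm_num) h5
    linarith [h1, h2.le, h3, h4]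
  -- the two estimates and the comparison
  have hX := handoffCrossConst_le_of_gap_le hcons hq hgap hη hηq hb
  have hlobe := lobeCoercivity_ge_of_level hℓ80 hD0 hDsmall hK2 hlogK hDK
  have hlogℓ : Real.log ℓ ≤ 3 + 0.01832 * ℓ := log_le_three_add hℓ0
  show handoffCrossConst q η b ≤ lobeCoercivity D K
  linarith [hX, hlobe, hlogℓ, hℓ80]

/-- The odd half alone, same hypotheses. [this track, ATTEMPT-8] -/
theorem edgeNonnegOdd_of_gap_le (hcons : ConsecutivePrimes q q') (hq : Real.exp 80 ≤ q)
    (hgap : (q' : ℝ) - q ≤ Real.sqrt q * Real.log q / 2) {η : ℝ} (hη : 0 < η) (hηq : η ≤ 1 / (4 * q)) :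
    EdgeNonnegOdd q q' η :=
  ((edgeNonneg_iff_even_and_odd q q' η).1 (edgeNonneg_of_gap_le hcons hq hgap hη hηq)).2

/-- **The two-sided classification of the odd edge block (ATTEMPT-7 §4(i), formal in both directions).** For
consecutive primes `q < q′` with `q ≥ e⁸⁰` and an overlap `0 < η ≤ 1/(4q)`:
`q′ − q ≤ ½·√q·log q ⟹ EdgeNonnegOdd q q′ η ⟹ q′ − q ≤ cramerGapConst·√q·log q`. So «the odd edge block at every
large q» lies between two Cramér-order prime-gap statements (both open unconditionally); an RH-free proof of it is an
RH-free Cramér-order gap theorem and conversely, up to the constant. Nothing here bears on RH.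
[this track, ATTEMPT-7 §4, ATTEMPT-8] -/
theorem edgeNonnegOdd_gap_sandwich (hcons : ConsecutivePrimes q q') (hq : Real.exp 80 ≤ q) {η : ℝ} (hη : 0 < η)
    (hηq : η ≤ 1 / (4 * q)) :
    ((q' : ℝ) - q ≤ Real.sqrt q * Real.log q / 2 → EdgeNonnegOdd q q' η) ∧
      (EdgeNonnegOdd q q' η → (q' : ℝ) - q ≤ cramerGapConst * Real.sqrt q * Real.log q) := by
  have h7 : (10 : ℝ) ^ 7 ≤ q :=
    ten_pow_seven_le_exp_seventeen.trans ((Real.exp_le_exp.2 (by norm_num)).trans hq)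
  exact ⟨fun hgap ↦ edgeNonnegOdd_of_gap_le hcons hq hgap hη hηq,
    fun hE ↦ gap_le_of_edgeNonnegOdd hcons h7 hη hηq hE⟩

/-- **Under a Cramér-order gap hypothesis the edge block holds for every large prime.** If every prime gap from `q₁`
on satisfies `q′ − q ≤ ½·√q·log q` (a consequence of Cramér's conjecture `q′ − q = O(log² q)`; open), then
`EdgeNonneg q q′ η` for all consecutive primes with `q ≥ max(q₁, e⁸⁰)` and all overlaps `0 < η ≤ 1/(4q)`. Book-keeping
form of `edgeNonneg_of_gap_le`; nothing here bears on RH. [this track, ATTEMPT-8] -/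
theorem forall_edgeNonneg_of_gap_hypothesis {q₁ : ℝ}
    (hC : ∀ q q' : ℕ, ConsecutivePrimes q q' → q₁ ≤ q → (q' : ℝ) - q ≤ Real.sqrt q * Real.log q / 2)
    (hcons : ConsecutivePrimes q q') (hq : max q₁ (Real.exp 80) ≤ q) {η : ℝ} (hη : 0 < η)
    (hηq : η ≤ 1 / (4 * q)) : EdgeNonneg q q' η :=
  edgeNonneg_of_gap_le hcons ((le_max_right _ _).trans hq) (hC q q' hcons ((le_max_left _ _).trans hq)) hη hηq

end Summit.RiemannHypothesis.RiemannHypothesis.Theorems.Handoff
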